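import Mathlib
import HarnessLib

/-!
# Barrier: the graded Neumann packing bound — `J`-separated triples have volume `≤ (2/(3√3) + o(1))·(dim J)^{3/2}` (proved)

Topic `Literature/Barriers/MatrixMultiplication` (D-0021 barrier catalogue for the summit
`MatrixMultiplication`, `ω(ℂ) = 2`; group-theoretic approach of Cohn–Umans, LEVEL-GRADED designs:
route `MatrixMultiplication/LevelGradedCohnUmans` and the `SnSubsetDichotomy` family — items
`SnLevelDesigns`, `LieRankDesigns`, `LevelOneGL2Designs`, `GradedDesignFamily`). Everything in this
file is PROVED; it is the catalogue form (work item `wi-32182`, coordinator request 2026-08-16) of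
the group-free half of the tree's refutation of `LevelGradedCohnUmans.LevelTwoBeatsCubes`
(`Summits/MatrixMultiplication/MatrixMultiplication/Theorems/LevelGradedCohnUmansLevelTwoBeatsCubesRefutation.lean`
with `…/Theorems/LevelTwoBeatsCubes/Negative/GradedNeumannCount.lean`, idea card
`graded-neumann-rank`), whose proofs are reproduced here verbatim up to names (a Literature file
cannot import `Summits`).

## The bound

Let `G` be a finite group, `J ≤ ℂ^G` a subspace of functions and `X, Y, Z ⊆ G` finite sets.
Say `(X, Y, Z)` is **`J`-separated** (`GradedPacking.IsSeparated`; the design axiom of a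
level-graded Cohn–Umans construction supported on the test space `J`) if for every target
`(x₀, z₀) ∈ X × Z` some `f ∈ J` satisfies `f(x⁻¹ y y'⁻¹ z) = [x = x₀ ∧ y = y' ∧ z = z₀]` for all
`x ∈ X`, `y, y' ∈ Y`, `z ∈ Z`. (For `J = ℂ^G` this is implied by the triple product property of
`(X, Y, Z)`, with `f = δ_{x₀⁻¹z₀}`.) Then, with `D = dim J`:

* (`GradedPacking.packing_right`) if `J` is right-translation invariant and `Y, Z ≠ ∅`:
  `|X||Z| + |X|(|Y| − 1) ≤ D` — the targets `x⁻¹z` and ONE translated slab `x⁻¹ y y₁⁻¹ z₁`,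
  `y ≠ y₁`, are hit by a block-triangular family of functions of `J`
  (`GradedPacking.card_add_card_le_finrank`);
* (`GradedPacking.packing_left`) if `J` is left-translation invariant and `X, Y ≠ ∅`:
  `|X||Z| + (|Y| − 1)|Z| ≤ D`;
* (`GradedPacking.cubic_le_real`, `GradedPacking.volume_le_of_counts`) the two counts give
  `|X||Y||Z| ≤ pD + p² − p³` for `p = min(|X|, |Z|)`, hence `|X||Y||Z| ≤ B` for every real `B`
  with `4D + 1 ≤ 8B` and `4(4D + 1)³ ≤ 27(8B − 4D − 1)²` (AM–GM at the critical point of the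
  cubic);
* (`GradedPacking.volume_le`) in closed form, for a BI-invariant `J` (both counts available):
  `|X||Y||Z| ≤ (4D + 1)/8 + (4D + 1)√(4D + 1)/(12√3) = (2/(3√3))·D^{3/2}·(1 + o(1)) ≈ 0.3849·D^{3/2}`.

This is the `J`-graded form of P. M. Neumann's packing inequalities `s₁(s₂ + s₃ − 1) ≤ |G|` for
TPP triples (Neumann 2011, Observation 3.1 — the case `J = ℂ^G`, `D = |G|`, of `packing_right`
up to the roles of the three sets), and of the cubic consequence `|S||T||U| < |G|^{3/2}`
(Cohn–Umans 2003, proof of Lemma 3.1; Neumann 2011, §1).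

## Catalogue entry

The D-0021 structured block is in the docstring of `GradedPackingBound` at the end of the file;
`gradedPackingBound_holds` proves it.

## Design choices

* `J`-separation is stated for an arbitrary subspace `J ≤ ℂ^G` (`Submodule ℂ (G → ℂ)`) and finite
  sets `X, Y, Z : Finset G`; translation invariance is the closure of `J` under `f ↦ f(· h)`
  (right) / `f ↦ f(h ·)` (left). The refuted route item used the bi-invariant 2-token space
  `J₂(𝔖ₙ)`; the level-`k` pieces of a level-graded design are two-sided ideals of `ℂ[G]`, hence
  bi-invariant, which is what the volume bound needs (ONE-sided invariance yields one count only).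
* Cardinalities are `Finset.card`, dimensions `Module.finrank ℂ`; the closed form is over `ℝ`
  with `Real.sqrt`, derived from the exact certificate `4(4D+1)³ = 27(8B₀ − 4D − 1)²` at
  `B₀ = (4D+1)/8 + (4D+1)√(4D+1)/(12√3)`, so no rounding enters.

## References

* [Neumann2011] P. M. Neumann, *A note on the triple product property for subsets of finite
  groups*, LMS J. Comput. Math. 14 (2011) 232–237: Observation 2.1, Observation 3.1 (held, text
  read: p. 234).
* [CohnUmans2003] H. Cohn, C. Umans, *A group-theoretic approach to fast matrix multiplication*,
  FOCS 2003: Def. 2.1 (TPP), Lemma 3.1 and its proof (`β(G) < n^{3/2}`), Thm. 2.3.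
* Tree: `Summits/MatrixMultiplication/MatrixMultiplication/Theorems/LevelTwoBeatsCubes/Negative/GradedNeumannCount.lean`
  and `…/Theorems/LevelGradedCohnUmansLevelTwoBeatsCubesRefutation.lean` (refutation of
  stmt-MatrixMultiplication-7612, 2026-08-16).
-/

noncomputable section

open scoped BigOperators

namespace Literature.Barriers.MatrixMultiplication

namespace GradedPacking

open Module

/-! ## Block-triangular evaluation count -/

section LinearAlgebra

variable {G : Type*} {A S : Type*} [Fintype A] [Fintype S]

/-- **Block-triangular evaluation count.** If `J ≤ ℂ^G` contains, for each `a₀ : A`, a function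
equal to `δ_{a₀}` on the points `tA a` and vanishing on the points `tS s`, and for each `s₀ : S` a
function equal to `δ_{s₀}` on the points `tS s`, then `|A| + |S| ≤ dim J` (the evaluation map
`J → ℂ^{A ⊕ S}` is onto: its image contains the `δ`'s of the `A`-block, and those of the `S`-block
modulo the `A`-block). Proof reproduced from the tree's `GradedNeumannCount.lean`. [folklore] -/
theorem card_add_card_le_finrank [Fintype G] (J : Submodule ℂ (G → ℂ)) (tA : A → G) (tS : S → G)
    (hA : ∀ a₀ : A, ∃ f ∈ J, f (tA a₀) = 1 ∧ (∀ a, a ≠ a₀ → f (tA a) = 0) ∧ ∀ s, f (tS s) = 0)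
    (hS : ∀ s₀ : S, ∃ f ∈ J, f (tS s₀) = 1 ∧ ∀ s, s ≠ s₀ → f (tS s) = 0) :
    Fintype.card A + Fintype.card S ≤ finrank ℂ J := by
  classical
  let t : A ⊕ S → G := Sum.elim tA tS
  let ψ : J →ₗ[ℂ] (A ⊕ S → ℂ) :=
    { toFun := fun f i => (f : G → ℂ) (t i)
      map_add' := fun f g => by funext i; simp
      map_smul' := fun c f => by funext i; simp }
  have hψ : ∀ (f : J) (i : A ⊕ S), ψ f i = (f : G → ℂ) (t i) := fun f i => rfl
  let e : A ⊕ S → (A ⊕ S → ℂ) := fun i j => if i = j then 1 else 0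
  have he_inl : ∀ a₀ : A, e (Sum.inl a₀) ∈ LinearMap.range ψ := by
    intro a₀
    obtain ⟨f, hf, h1, h0, hs⟩ := hA a₀
    refine LinearMap.mem_range.2 ⟨⟨f, hf⟩, ?_⟩
    funext j
    rcases j with a | s
    · by_cases h : a = a₀
      · subst h
        simp [hψ, e, t, h1]
      · have hne : a₀ ≠ a := fun h' => h h'.symm
        simp [hψ, e, t, h0 a h, hne]
    · simp [hψ, e, t, hs]
  have he_inr : ∀ s₀ : S, e (Sum.inr s₀) ∈ LinearMap.range ψ := by
    intro s₀
    obtain ⟨f, hf, h1, h0⟩ := hS s₀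
    have hu : ψ ⟨f, hf⟩ ∈ LinearMap.range ψ := LinearMap.mem_range_self ψ _
    have key : e (Sum.inr s₀) =
        ψ ⟨f, hf⟩ - ∑ a : A, (ψ ⟨f, hf⟩ (Sum.inl a)) • e (Sum.inl a) := by
      funext j
      rcases j with a | s
      · simp [hψ, e, t, Finset.sum_apply]
      · by_cases h : s = s₀
        · subst h
          simp [hψ, e, t, h1, Finset.sum_apply]
        · have hne : s₀ ≠ s := fun h' => h h'.symm
          simp [hψ, e, t, h0 s h, hne, Finset.sum_apply]
    rw [key]
    exact Submodule.sub_mem _ hu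
      (Submodule.sum_mem _ fun a _ => Submodule.smul_mem _ _ (he_inl a))
  have htop : LinearMap.range ψ = ⊤ := by
    rw [eq_top_iff]
    rintro v -
    rw [pi_eq_sum_univ v]
    refine Submodule.sum_mem _ fun i _ => Submodule.smul_mem _ _ ?_
    rcases i with a | s
    · exact he_inl a
    · exact he_inr s
  have hsurj : Function.Surjective ψ := LinearMap.range_eq_top.1 htop
  calc Fintype.card A + Fintype.card S = Fintype.card (A ⊕ S) := Fintype.card_sum.symm
    _ = finrank ℂ (A ⊕ S → ℂ) := (Module.finrank_fintype_fun_eq_card ℂ).symm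
    _ ≤ finrank ℂ J := LinearMap.finrank_le_finrank_of_surjective hsurj

end LinearAlgebra

/-! ## `J`-separated triples and the graded Neumann count -/

section Packing

variable {G : Type*} [Group G]

/-- **`J`-separated triple** (the design axiom of a level-graded Cohn–Umans construction supported
on the test space `J ≤ ℂ^G`): for every target `(x₀, z₀) ∈ X × Z` there is `f ∈ J` with
`f(x⁻¹ y y'⁻¹ z) = [x = x₀ ∧ y = y' ∧ z = z₀]` on `X × Y × Y × Z`. For `J = ℂ^G` (all functions)
this follows from the triple product property of `(X, Y, Z)` (Cohn–Umans 2003, Def. 2.1) with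
`f = δ_{x₀⁻¹ z₀}`; the route `LevelGradedCohnUmans` asks for it with `J` a level-graded piece of
`ℂ[G]`. [folklore] -/
def IsSeparated (J : Submodule ℂ (G → ℂ)) (X Y Z : Finset G) : Prop :=
  ∀ x₀ ∈ X, ∀ z₀ ∈ Z, ∃ f ∈ J, ∀ x ∈ X, ∀ y ∈ Y, ∀ y' ∈ Y, ∀ z ∈ Z,
    (x = x₀ ∧ y = y' ∧ z = z₀ → f (x⁻¹ * y * y'⁻¹ * z) = 1) ∧
    (¬ (x = x₀ ∧ y = y' ∧ z = z₀) → f (x⁻¹ * y * y'⁻¹ * z) = 0)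

/-- Unfolding of `IsSeparated`. [folklore] -/
theorem isSeparated_iff (J : Submodule ℂ (G → ℂ)) (X Y Z : Finset G) :
    IsSeparated J X Y Z ↔ ∀ x₀ ∈ X, ∀ z₀ ∈ Z, ∃ f ∈ J, ∀ x ∈ X, ∀ y ∈ Y, ∀ y' ∈ Y, ∀ z ∈ Z,
      (x = x₀ ∧ y = y' ∧ z = z₀ → f (x⁻¹ * y * y'⁻¹ * z) = 1) ∧
      (¬ (x = x₀ ∧ y = y' ∧ z = z₀) → f (x⁻¹ * y * y'⁻¹ * z) = 0) :=
  Iff.rfl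

/-- Separation is monotone in the test space. [folklore] -/
theorem IsSeparated.mono {J J' : Submodule ℂ (G → ℂ)} (hJJ' : J ≤ J') {X Y Z : Finset G}
    (h : IsSeparated J X Y Z) : IsSeparated J' X Y Z := by
  intro x₀ hx₀ z₀ hz₀
  obtain ⟨f, hf, hspec⟩ := h x₀ hx₀ z₀ hz₀
  exact ⟨f, hJJ' hf, hspec⟩

variable [Fintype G]

/-- **Graded Neumann count, right-invariant test space.** If `(X, Y, Z)` is `J`-separated for a
right-translation-invariant `J ≤ ℂ^G` and `y₁ ∈ Y`, `z₁ ∈ Z`, then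
`|X||Z| + |X|(|Y| − 1) ≤ dim J`: the targets `x⁻¹ z` (`x ∈ X`, `z ∈ Z`) and the translated slab
`x⁻¹ y y₁⁻¹ z₁` (`x ∈ X`, `y ∈ Y ∖ {y₁}`) are hit block-triangularly by the separators and their
right translates. For `J = ℂ^G` this is Neumann's `s₁(s₂ + s₃ − 1) ≤ |G|` (his injectivity of
`(s, x) ↦ s⁻¹x` on `S₁ × (S₂ ∪ S₃)` for a basic TPP triple). Proof reproduced from the tree's
`GradedNeumannCount.packing_X`. [cite: Neumann2011, Observation 3.1] -/
theorem packing_right (J : Submodule ℂ (G → ℂ)) (hr : ∀ f ∈ J, ∀ h : G, (fun g => f (g * h)) ∈ J)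
    (X Y Z : Finset G) (hsep : IsSeparated J X Y Z) {y₁ z₁ : G} (hy₁ : y₁ ∈ Y) (hz₁ : z₁ ∈ Z) :
    X.card * Z.card + X.card * (Y.card - 1) ≤ finrank ℂ J := by
  classical
  have h := card_add_card_le_finrank (A := ↥(X ×ˢ Z)) (S := ↥(X ×ˢ Y.erase y₁)) J
    (fun a => a.1.1⁻¹ * y₁ * y₁⁻¹ * a.1.2) (fun s => s.1.1⁻¹ * s.1.2 * y₁⁻¹ * z₁) ?_ ?_
  · simp only [Fintype.card_coe] at h
    rw [Finset.card_product, Finset.card_product, Finset.card_erase_of_mem hy₁] at h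
    exact h
  · rintro ⟨⟨x₀, z₀⟩, h₀⟩
    rw [Finset.mem_product] at h₀
    obtain ⟨f, hf, hspec⟩ := hsep x₀ h₀.1 z₀ h₀.2
    refine ⟨f, hf, ?_, ?_, ?_⟩
    · exact (hspec x₀ h₀.1 y₁ hy₁ y₁ hy₁ z₀ h₀.2).1 ⟨rfl, rfl, rfl⟩
    · rintro ⟨⟨x, z⟩, hxz⟩ hne
      rw [Finset.mem_product] at hxz
      refine (hspec x hxz.1 y₁ hy₁ y₁ hy₁ z hxz.2).2 ?_
      rintro ⟨rfl, -, rfl⟩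
      exact hne rfl
    · rintro ⟨⟨x, y⟩, hxy⟩
      rw [Finset.mem_product, Finset.mem_erase] at hxy
      refine (hspec x hxy.1 y hxy.2.2 y₁ hy₁ z₁ hz₁).2 ?_
      rintro ⟨-, hyy, -⟩
      exact hxy.2.1 hyy
  · rintro ⟨⟨x₀, y₀⟩, h₀⟩
    rw [Finset.mem_product, Finset.mem_erase] at h₀
    obtain ⟨f, hf, hspec⟩ := hsep x₀ h₀.1 z₁ hz₁
    refine ⟨fun g => f (g * (z₁⁻¹ * y₁ * y₀⁻¹ * z₁)), hr f hf _, ?_, ?_⟩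
    · have e : x₀⁻¹ * y₀ * y₁⁻¹ * z₁ * (z₁⁻¹ * y₁ * y₀⁻¹ * z₁) = x₀⁻¹ * y₀ * y₀⁻¹ * z₁ := by group
      show f (x₀⁻¹ * y₀ * y₁⁻¹ * z₁ * (z₁⁻¹ * y₁ * y₀⁻¹ * z₁)) = 1
      rw [e]
      exact (hspec x₀ h₀.1 y₀ h₀.2.2 y₀ h₀.2.2 z₁ hz₁).1 ⟨rfl, rfl, rfl⟩
    · rintro ⟨⟨x, y⟩, hxy⟩ hne
      rw [Finset.mem_product, Finset.mem_erase] at hxy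
      have e : x⁻¹ * y * y₁⁻¹ * z₁ * (z₁⁻¹ * y₁ * y₀⁻¹ * z₁) = x⁻¹ * y * y₀⁻¹ * z₁ := by group
      show f (x⁻¹ * y * y₁⁻¹ * z₁ * (z₁⁻¹ * y₁ * y₀⁻¹ * z₁)) = 0
      rw [e]
      refine (hspec x hxy.1 y hxy.2.2 y₀ h₀.2.2 z₁ hz₁).2 ?_
      rintro ⟨rfl, rfl, -⟩
      exact hne rfl

/-- **Graded Neumann count, left-invariant test space.** If `(X, Y, Z)` is `J`-separated for a
left-translation-invariant `J ≤ ℂ^G` and `x₁ ∈ X`, `y₁ ∈ Y`, then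
`|X||Z| + (|Y| − 1)|Z| ≤ dim J`. Proof reproduced from the tree's `GradedNeumannCount.packing_Z`.
[cite: Neumann2011, Observation 3.1] -/
theorem packing_left (J : Submodule ℂ (G → ℂ)) (hl : ∀ f ∈ J, ∀ h : G, (fun g => f (h * g)) ∈ J)
    (X Y Z : Finset G) (hsep : IsSeparated J X Y Z) {x₁ y₁ : G} (hx₁ : x₁ ∈ X) (hy₁ : y₁ ∈ Y) :
    X.card * Z.card + (Y.card - 1) * Z.card ≤ finrank ℂ J := by
  classical
  have h := card_add_card_le_finrank (A := ↥(X ×ˢ Z)) (S := ↥(Y.erase y₁ ×ˢ Z)) J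
    (fun a => a.1.1⁻¹ * y₁ * y₁⁻¹ * a.1.2) (fun s => x₁⁻¹ * y₁ * s.1.1⁻¹ * s.1.2) ?_ ?_
  · simp only [Fintype.card_coe] at h
    rw [Finset.card_product, Finset.card_product, Finset.card_erase_of_mem hy₁] at h
    exact h
  · rintro ⟨⟨x₀, z₀⟩, h₀⟩
    rw [Finset.mem_product] at h₀
    obtain ⟨f, hf, hspec⟩ := hsep x₀ h₀.1 z₀ h₀.2
    refine ⟨f, hf, ?_, ?_, ?_⟩
    · exact (hspec x₀ h₀.1 y₁ hy₁ y₁ hy₁ z₀ h₀.2).1 ⟨rfl, rfl, rfl⟩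
    · rintro ⟨⟨x, z⟩, hxz⟩ hne
      rw [Finset.mem_product] at hxz
      refine (hspec x hxz.1 y₁ hy₁ y₁ hy₁ z hxz.2).2 ?_
      rintro ⟨rfl, -, rfl⟩
      exact hne rfl
    · rintro ⟨⟨y, z⟩, hyz⟩
      rw [Finset.mem_product, Finset.mem_erase] at hyz
      refine (hspec x₁ hx₁ y₁ hy₁ y hyz.1.2 z hyz.2).2 ?_
      rintro ⟨-, hyy, -⟩
      exact hyz.1.1 hyy.symm
  · rintro ⟨⟨y₀, z₀⟩, h₀⟩
    rw [Finset.mem_product, Finset.mem_erase] at h₀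
    obtain ⟨f, hf, hspec⟩ := hsep x₁ hx₁ z₀ h₀.2
    refine ⟨fun g => f ((x₁⁻¹ * y₀ * y₁⁻¹ * x₁) * g), hl f hf _, ?_, ?_⟩
    · have e : x₁⁻¹ * y₀ * y₁⁻¹ * x₁ * (x₁⁻¹ * y₁ * y₀⁻¹ * z₀) = x₁⁻¹ * y₀ * y₀⁻¹ * z₀ := by group
      show f (x₁⁻¹ * y₀ * y₁⁻¹ * x₁ * (x₁⁻¹ * y₁ * y₀⁻¹ * z₀)) = 1
      rw [e]
      exact (hspec x₁ hx₁ y₀ h₀.1.2 y₀ h₀.1.2 z₀ h₀.2).1 ⟨rfl, rfl, rfl⟩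
    · rintro ⟨⟨y, z⟩, hyz⟩ hne
      rw [Finset.mem_product, Finset.mem_erase] at hyz
      have e : x₁⁻¹ * y₀ * y₁⁻¹ * x₁ * (x₁⁻¹ * y₁ * y⁻¹ * z) = x₁⁻¹ * y₀ * y⁻¹ * z := by group
      show f (x₁⁻¹ * y₀ * y₁⁻¹ * x₁ * (x₁⁻¹ * y₁ * y⁻¹ * z)) = 0
      rw [e]
      refine (hspec x₁ hx₁ y₀ h₀.1.2 y hyz.1.2 z hyz.2).2 ?_
      rintro ⟨-, rfl, rfl⟩
      exact hne rfl

end Packing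

/-! ## The cubic volume budget -/

section Arith

/-- **The cubic budget.** If `0 ≤ D`, `4D + 1 ≤ 8B` and `4(4D+1)³ ≤ 27(8B − 4D − 1)²` then
`pD + p² − p³ ≤ B` for every real `p ≥ 0` (AM–GM at the critical point of the cubic). Proof
reproduced from the tree's `GradedNeumannCount.cubic_le_real`. [folklore] -/
theorem cubic_le_real (D B p : ℝ) (hD : 0 ≤ D) (hp : 0 ≤ p) (h1 : 4 * D + 1 ≤ 8 * B)
    (h2 : 4 * (4 * D + 1) ^ 3 ≤ 27 * (8 * B - 4 * D - 1) ^ 2) :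
    p * D + p ^ 2 - p ^ 3 ≤ B := by
  have hval : p * D + p ^ 2 - p ^ 3 = p * (D + p - p ^ 2) := by ring
  rw [hval]
  by_cases hyneg : D + p - p ^ 2 < 0
  · have : p * (D + p - p ^ 2) ≤ 0 := mul_nonpos_of_nonneg_of_nonpos hp hyneg.le
    linarith
  push Not at hyneg
  -- AM-GM: 27 · x · y · y ≤ (x + 2y)³ with x = 2 (p - 1/2)², y = D + p - p², x + 2y = 2D + 1/2
  have hamgm : 27 * (2 * (p - 1 / 2) ^ 2) * (D + p - p ^ 2) ^ 2 ≤ (2 * D + 1 / 2) ^ 3 := by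
    have hsum : (2 * (p - 1 / 2) ^ 2) + 2 * (D + p - p ^ 2) = 2 * D + 1 / 2 := by ring
    have key : ((2 * (p - 1 / 2) ^ 2) + 2 * (D + p - p ^ 2)) ^ 3
        - 27 * (2 * (p - 1 / 2) ^ 2) * (D + p - p ^ 2) ^ 2
        = ((2 * (p - 1 / 2) ^ 2) - (D + p - p ^ 2)) ^ 2
          * ((2 * (p - 1 / 2) ^ 2) + 8 * (D + p - p ^ 2)) := by ring
    have hnn : (0 : ℝ) ≤ ((2 * (p - 1 / 2) ^ 2) - (D + p - p ^ 2)) ^ 2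
          * ((2 * (p - 1 / 2) ^ 2) + 8 * (D + p - p ^ 2)) := by positivity
    rw [← hsum]
    linarith
  have hyle : D + p - p ^ 2 ≤ D + 1 / 4 := by nlinarith [sq_nonneg (p - 1 / 2)]
  by_contra hcon
  push Not at hcon
  have ht : B - (D + 1 / 4) / 2 < (p - 1 / 2) * (D + p - p ^ 2) := by nlinarith
  have hB0 : 0 ≤ B - (D + 1 / 4) / 2 := by linarith
  have hsq : (B - (D + 1 / 4) / 2) * (B - (D + 1 / 4) / 2)
      < ((p - 1 / 2) * (D + p - p ^ 2)) * ((p - 1 / 2) * (D + p - p ^ 2)) :=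
    mul_self_lt_mul_self hB0 ht
  have h27 : 27 * (((p - 1 / 2) * (D + p - p ^ 2)) * ((p - 1 / 2) * (D + p - p ^ 2)))
      ≤ (2 * D + 1 / 2) ^ 3 / 2 := by
    have : ((p - 1 / 2) * (D + p - p ^ 2)) * ((p - 1 / 2) * (D + p - p ^ 2))
        = (2 * (p - 1 / 2) ^ 2) * (D + p - p ^ 2) ^ 2 / 2 := by ring
    rw [this]
    linarith
  nlinarith

/-- **From the two counts to the volume** (real budget `B`): if `1 ≤ b`, `ac + a(b−1) ≤ D`,
`ac + (b−1)c ≤ D` and `pD + p² ≤ p³ + B` for every natural `p`, then `abc ≤ B` — multiply the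
count through by `p = min(a, c)` and use `p(p−1)(max − p) ≥ 0`. The tree's
`GradedNeumannCount.vol_le`, with the budget taken real. [folklore] -/
theorem volume_le_of_counts (a b c D : ℕ) (B : ℝ) (hb : 1 ≤ b)
    (N1 : a * c + a * (b - 1) ≤ D) (N2 : a * c + (b - 1) * c ≤ D)
    (hh : ∀ p : ℕ, (p * D + p ^ 2 : ℝ) ≤ p ^ 3 + B) : (a * b * c : ℝ) ≤ B := by
  obtain ⟨b, rfl⟩ : ∃ b', b = b' + 1 := ⟨b - 1, by omega⟩
  simp only [Nat.add_sub_cancel] at N1 N2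
  have hB0 : 0 ≤ B := by simpa using hh 0
  rcases Nat.eq_zero_or_pos a with rfl | ha0
  · simpa using hB0
  rcases Nat.eq_zero_or_pos c with rfl | hc0
  · simpa using hB0
  rcases le_total c a with hca | hac
  · have hc := hh c
    have key : c * (a * c + a * b) ≤ c * D := Nat.mul_le_mul_left _ N1
    have key' : (c : ℝ) * (a * c + a * b) ≤ c * D := by exact_mod_cast key
    have hca' : (c : ℝ) ≤ a := by exact_mod_cast hca
    have hc1 : (1 : ℝ) ≤ c := by exact_mod_cast hc0
    have hint : (0 : ℝ) ≤ c * (a - c) * (c - 1) :=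
      mul_nonneg (mul_nonneg (by linarith) (by linarith)) (by linarith)
    push_cast
    nlinarith [key', hc, hint]
  · have ha := hh a
    have key : a * (a * c + b * c) ≤ a * D := Nat.mul_le_mul_left _ N2
    have key' : (a : ℝ) * (a * c + b * c) ≤ a * D := by exact_mod_cast key
    have hac' : (a : ℝ) ≤ c := by exact_mod_cast hac
    have ha1 : (1 : ℝ) ≤ a := by exact_mod_cast ha0
    have hint : (0 : ℝ) ≤ a * (c - a) * (a - 1) :=
      mul_nonneg (mul_nonneg (by linarith) (by linarith)) (by linarith)
    push_cast
    nlinarith [key', ha, hint]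

/-- **The closed-form budget** `B₀(D) = (4D+1)/8 + (4D+1)√(4D+1)/(12√3)` satisfies the two
conditions of the cubic budget, the second with equality: `8B₀ − 4D − 1 = 2(4D+1)√(4D+1)/(3√3)`,
whose square is `4(4D+1)³/27`. [folklore] -/
theorem closedForm_conditions (D : ℝ) (hD : 0 ≤ D) :
    4 * D + 1 ≤ 8 * ((4 * D + 1) / 8 + (4 * D + 1) * Real.sqrt (4 * D + 1) / (12 * Real.sqrt 3)) ∧
    4 * (4 * D + 1) ^ 3 ≤
      27 * (8 * ((4 * D + 1) / 8 + (4 * D + 1) * Real.sqrt (4 * D + 1) / (12 * Real.sqrt 3))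
        - 4 * D - 1) ^ 2 := by
  set s := Real.sqrt (4 * D + 1) with hs
  set t := Real.sqrt 3 with ht
  have htpos : 0 < t := Real.sqrt_pos.2 (by norm_num)
  have hs2 : s ^ 2 = 4 * D + 1 := Real.sq_sqrt (by linarith)
  have ht2 : t ^ 2 = 3 := Real.sq_sqrt (by norm_num)
  have hs0 : 0 ≤ s := Real.sqrt_nonneg _
  constructor
  · have : 0 ≤ (4 * D + 1) * s / (12 * t) := by positivity
    linarith
  · have e : 8 * ((4 * D + 1) / 8 + (4 * D + 1) * s / (12 * t)) - 4 * D - 1 =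
        2 * (4 * D + 1) * s / (3 * t) := by
      field_simp
      ring
    rw [e, div_pow, mul_pow, mul_pow, mul_pow, hs2, ht2]
    have e2 : (27 : ℝ) * (2 ^ 2 * (4 * D + 1) ^ 2 * (4 * D + 1) / (3 ^ 2 * 3)) =
        4 * (4 * D + 1) ^ 3 := by ring
    rw [e2]

/-- **The graded packing bound in closed form**: the two counts `ac + a(b−1) ≤ D` and
`ac + (b−1)c ≤ D` (with `b ≥ 1`) force
`abc ≤ (4D+1)/8 + (4D+1)√(4D+1)/(12√3) = (2/(3√3) + o(1))·D^{3/2}`. [folklore] -/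
theorem volume_le_closedForm (a b c D : ℕ) (hb : 1 ≤ b)
    (N1 : a * c + a * (b - 1) ≤ D) (N2 : a * c + (b - 1) * c ≤ D) :
    (a * b * c : ℝ) ≤
      (4 * D + 1) / 8 + (4 * D + 1) * Real.sqrt (4 * D + 1) / (12 * Real.sqrt 3) := by
  obtain ⟨h1, h2⟩ := closedForm_conditions (D : ℝ) (Nat.cast_nonneg D)
  refine volume_le_of_counts a b c D _ hb N1 N2 fun p => ?_
  have h := cubic_le_real D _ p (Nat.cast_nonneg D) (Nat.cast_nonneg p) h1 h2
  linarith

variable {G : Type*} [Group G] [Fintype G]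

/-- **Volume of a `J`-separated triple for a bi-invariant test space** (the numerical barrier):
if `J ≤ ℂ^G` is left- and right-translation invariant and `(X, Y, Z)` is `J`-separated, then
`|X||Y||Z| ≤ (4D+1)/8 + (4D+1)√(4D+1)/(12√3)`, `D = dim J` — about `0.3849·D^{3/2}`. (Empty
`X`, `Y` or `Z` give volume `0`.) [folklore] -/
theorem volume_le (J : Submodule ℂ (G → ℂ)) (hl : ∀ f ∈ J, ∀ h : G, (fun g => f (h * g)) ∈ J)
    (hr : ∀ f ∈ J, ∀ h : G, (fun g => f (g * h)) ∈ J) (X Y Z : Finset G)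
    (hsep : IsSeparated J X Y Z) :
    (X.card * Y.card * Z.card : ℝ) ≤
      (4 * Module.finrank ℂ J + 1) / 8 + (4 * Module.finrank ℂ J + 1) *
        Real.sqrt (4 * Module.finrank ℂ J + 1) / (12 * Real.sqrt 3) := by
  classical
  set D := Module.finrank ℂ J with hD
  have hB0 : (0 : ℝ) ≤ (4 * D + 1) / 8 + (4 * D + 1) * Real.sqrt (4 * D + 1) / (12 * Real.sqrt 3) := by
    positivity
  by_cases hX : X.card = 0
  · rw [hX]; simpa using hB0
  by_cases hY : Y.card = 0
  · rw [hY]; simpa using hB0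
  by_cases hZ : Z.card = 0
  · rw [hZ]; simpa using hB0
  obtain ⟨x₁, hx₁⟩ := Finset.card_ne_zero.1 hX
  obtain ⟨y₁, hy₁⟩ := Finset.card_ne_zero.1 hY
  obtain ⟨z₁, hz₁⟩ := Finset.card_ne_zero.1 hZ
  have N1 := packing_right J hr X Y Z hsep hy₁ hz₁
  have N2 := packing_left J hl X Y Z hsep hx₁ hy₁
  exact_mod_cast volume_le_closedForm X.card Y.card Z.card D (Nat.pos_of_ne_zero hY) N1 N2

end Arith

end GradedPacking

/-! ## Catalogue entry (D-0021) -/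

section Catalogue

open GradedPacking

/-- **Graded Neumann packing bound for `J`-separated (level-graded Cohn–Umans) triples.** The
catalogue entry: over all finite groups `G` (in `Type`), subspaces `J ≤ ℂ^G` and finite
`X, Y, Z ⊆ G` that are `J`-separated (`GradedPacking.IsSeparated`): (1) for right-invariant `J`
and `Y, Z ≠ ∅`, `|X||Z| + |X|(|Y|−1) ≤ dim J`; (2) for left-invariant `J` and `X, Y ≠ ∅`,
`|X||Z| + (|Y|−1)|Z| ≤ dim J`; (3) for bi-invariant `J`,
`|X||Y||Z| ≤ (4 dim J + 1)/8 + (4 dim J + 1)√(4 dim J + 1)/(12√3) ≈ 0.3849·(dim J)^{3/2}`.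
PROVED below (`gradedPackingBound_holds`). [barrier: MatrixMultiplication]

BARRIER
technique_class: group-theoretic-approach, Cohn–Umans, LEVEL-GRADED / `J`-separated designs: triples `X, Y, Z ⊆ G` whose targets `(x₀, z₀)` are separated on `X⁻¹ Y Y⁻¹ Z` by functions of a translation-invariant test space `J ≤ ℂ^G` (`GradedPacking.IsSeparated`) — the `k`-token spaces `J_k(𝔖ₙ)` of `SnLevelDesigns` / `LevelTwoBeatsCubes`, Lie-rank-graded pieces (`LieRankDesigns`), level-one `GL₂` pieces (`LevelOneGL2Designs`), graded design families (`GradedDesignFamily`) of the routes `MatrixMultiplication/LevelGradedCohnUmans` and `SnSubsetDichotomy`; the case `J = ℂ^G` is the plain triple product property [cite: CohnUmans2003, Def. 2.1] with Neumann's packing inequalities [cite: Neumann2011, Observation 3.1]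
blocks: any volume target above `(2/(3√3) + o(1))·(dim J)^{3/2} ≈ 0.385·(dim J)^{3/2}` for a `J`-separated triple with bi-invariant `J` (`GradedPacking.volume_le`, proved in this file), and already `|X||Z| + |X|(|Y|−1) ≤ dim J` for right-invariant `J`, `|X||Z| + (|Y|−1)|Z| ≤ dim J` for left-invariant `J`, hence `|X||Z| + max(|X|,|Z|)(|Y|−1) ≤ dim J` for bi-invariant `J` (`GradedPacking.packing_right`, `GradedPacking.packing_left`, proved in this file); in particular the refuted level-2 window `|X||Y||Z| > B₃(n) = 1 + (n−1)³ + (n(n−3)/2)³ + ((n−1)(n−2)/2)³ ≈ 0.707·(dim J₂)^{3/2}` of `LevelGradedCohnUmans.LevelTwoBeatsCubes` (stmt-MatrixMultiplication-7612, tree refutation `LevelGradedCohnUmansLevelTwoBeatsCubes_refuted`, 2026-08-16) and every level-`k` analogue whose threshold exceeds `0.385·(dim J_k)^{3/2}(1+o(1))`; this is the graded form of "`β(G) < n^{3/2}`" for TPP triples [cite: CohnUmans2003, Lemma 3.1 (proof)] [cite: Neumann2011, §1 and Observation 3.1].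
because: the separators of the targets `x⁻¹z` together with the right translates by `z₁⁻¹ y₁ y₀⁻¹ z₁` of the separators of `(x₀, z₁)` form a block-triangular family in `J` evaluated at the `|X||Z| + |X|(|Y|−1)` points `x⁻¹ z`, `x⁻¹ y y₁⁻¹ z₁` (`y ≠ y₁`), so the evaluation map `J → ℂ^{|X||Z| + |X|(|Y|−1)}` is onto (`GradedPacking.card_add_card_le_finrank`) — the `J`-graded version of Neumann's injectivity of `(s, x) ↦ s⁻¹x` on `S₁ × (S₂ ∪ S₃)` [cite: Neumann2011, Observation 3.1 (proof)]; symmetrically on the left; then with `p = min(|X|,|Z|)`, `D = dim J`: `|X||Y||Z| ≤ pD + p² − p³ ≤ max_{p ≥ 0}(pD + p² − p³) ≤ (4D+1)/8 + (4D+1)^{3/2}/(12√3)` by AM–GM (`GradedPacking.cubic_le_real`, `GradedPacking.closedForm_conditions`, proved in this file).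
evasions_known: none published for `J`-separated designs as such (the notion is the route's); within the count: (i) test spaces that are NOT translation invariant on either side escape clause (1)–(2) entirely (only `|X||Z| ≤ dim J` survives, from the targets alone), and one-sided invariance gives one count only, hence no `D^{3/2}` volume bound from this file (scope caveat (b)); (ii) the bound is `Θ(D^{3/2})`, the same order as the packing bound `|G|^{3/2}` needed for `ω = 2` in the ungraded setting [cite: CohnUmans2003, Lemma 3.1], so it kills thresholds by their CONSTANT (`0.707 > 0.385` at level 2), not by their exponent — a graded family with `dim J_k → ∞` and volume `c·(dim J_k)^{3/2}`, `c < 2/(3√3)`, is not excluded by this entry; (iii) simultaneous (STPP-type) graded families are not addressed.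
scope_caveats: (a) this is a theorem about `J`-SEPARATED triples in the exact sense of `GradedPacking.IsSeparated` (indicator of `x = x₀ ∧ y = y' ∧ z = z₀` on `X⁻¹YY⁻¹Z` realised inside `J`); designs with other separation patterns (e.g. separating `(x₀, y₀, z₀)` by functions on `X⁻¹Y × Y⁻¹Z`, or approximate/spectral separation) are not covered; (b) the volume clause (3) needs BOTH left- and right-invariance of `J` (two-sided ideals of `ℂ[G]`, e.g. the level pieces `J_k`); for a one-sided invariant `J` only the corresponding count (1) or (2) is asserted, and the work-item wording "one-sided-invariant … V ≤ 0.385·(dim J)^{3/2}" is NOT what is proved; (c) the constant: what is proved is `V ≤ (4D+1)/8 + (4D+1)√(4D+1)/(12√3)`, which is `0.3849…·D^{3/2}·(1 + O(D^{-1/2}))`; the bare inequality `V ≤ 0.385·D^{3/2}` fails for small `D` (e.g. `D = 1`, `X = Y = Z = {1}`, `J = ℂ·1`: `V = 1`); (d) no statement about `ω`: the entry bounds volumes of graded designs, and the link "volume below threshold ⇒ no improvement on `ω`" is the route's bookkeeping (`B₃(n)` etc.), not part of this file; (e) `G` finite and `J ≤ ℂ^G` complex-valued functions; other coefficient fields are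 not treated (the linear algebra is field-independent, the statement is not).
status: theorem (established; proved in this file — `gradedPackingBound_holds`; tree provenance: refutation of stmt-MatrixMultiplication-7612, `Theorems/LevelTwoBeatsCubes/Negative/GradedNeumannCount.lean`) [cite: Neumann2011, Observation 3.1] [cite: CohnUmans2003, Lemma 3.1] -/
def GradedPackingBound : Prop :=
  ∀ (G : Type) [Group G] [Fintype G] (J : Submodule ℂ (G → ℂ)) (X Y Z : Finset G),
    GradedPacking.IsSeparated J X Y Z →
      ((∀ f ∈ J, ∀ h : G, (fun g => f (g * h)) ∈ J) →
          ∀ y₁ ∈ Y, ∀ z₁ ∈ Z, X.card * Z.card + X.card * (Y.card - 1) ≤ Module.finrank ℂ J) ∧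
      ((∀ f ∈ J, ∀ h : G, (fun g => f (h * g)) ∈ J) →
          ∀ x₁ ∈ X, ∀ y₁ ∈ Y, X.card * Z.card + (Y.card - 1) * Z.card ≤ Module.finrank ℂ J) ∧
      ((∀ f ∈ J, ∀ h : G, (fun g => f (h * g)) ∈ J) → (∀ f ∈ J, ∀ h : G, (fun g => f (g * h)) ∈ J) →
          (X.card * Y.card * Z.card : ℝ) ≤
            (4 * Module.finrank ℂ J + 1) / 8 + (4 * Module.finrank ℂ J + 1) *
              Real.sqrt (4 * Module.finrank ℂ J + 1) / (12 * Real.sqrt 3))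

/-- **The graded packing bound holds** (proved above: `packing_right`, `packing_left`,
`volume_le`). [cite: Neumann2011, Observation 3.1] -/
theorem gradedPackingBound_holds : GradedPackingBound := by
  intro G _ _ J X Y Z hsep
  refine ⟨fun hr y₁ hy₁ z₁ hz₁ => packing_right J hr X Y Z hsep hy₁ hz₁,
    fun hl x₁ hx₁ y₁ hy₁ => packing_left J hl X Y Z hsep hx₁ hy₁,
    fun hl hr => volume_le J hl hr X Y Z hsep⟩

end Catalogue

end Literature.Barriers.MatrixMultiplication

end
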